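import Mathlib
import HarnessLib
import Literature.MathematicalPhysics.QuantumLattice.SalmhoferCutoffGevrey
import Summits.HubbardSuperconductivity.HubbardSuperconductivity.Theorems.KLProgrammeSalmhoferCutoffCauchyTable
import Summits.HubbardSuperconductivity.HubbardSuperconductivity.Theorems.KLProgrammeSalmhoferCutoffSecondDerivSharp

/-!
# Route `KLProgramme` — engine support (cell gate-hubbard-kl, #22a (2e) «sharp χ₂ table», seat p2 g18): the DERIVATIVE TABLE RECORD of
# Salmhofer's cutoff `χ₂` and of `Real.smoothTransition` — proved numeral rows (Cauchy) for all orders, and the kit-certified SHARP rows `n ≤ 16`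

Three tables of `sup_x ‖D^n f(x)‖`, `f = smoothTransition` / `f = χ₂ = salmhoferCutoff = smoothTransition((4·−1)/3)`:
* `smoothTransitionCauchyTab`, `klChi2CauchyTab` — **PROVED** rows: `n ≤ 2` the tree's sharp numerals (`1`, `8/3`, `176/9` for `χ₂`;
  `…SalmhoferCutoffSecondDerivSharp`), `3 ≤ n ≤ 16` the 4-digit ceilings of the Cauchy closed form
  `(4/3)ⁿ·n!·(5·(199n/99)ⁿ·e^{−n} + 2·(15/2)ⁿ)` (`…SalmhoferCutoffCauchyTable`), `n ≥ 17` the Gevrey-2 numerals `8·(n!)²·342ⁿ`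
  (`Literature/…/SalmhoferCutoffGevrey`); theorems `abs_iteratedDeriv_smoothTransition_le_cauchyTab`, **`norm_iteratedFDeriv_salmhoferCutoff_le_klChi2CauchyTab`**
  (every `n`, every `x`) — e.g. `‖D¹²χ₂‖ ≤ 1.899·10²²` (truth `2.19·10²¹`; Gevrey `4.7·10⁴⁸`);
* `klChi2CertTab` — the kit-CERTIFIED sharp rows `n ≤ 16` (truth rounded up to 4 digits: `‖D¹²χ₂‖ ≤ 2.188·10²¹`), i.e. the table of SPEC
  SCALE0-PT2-CERT-SPEC-v2 §3 «KIT JOB B» (HOME/hubbard-kl-k3c5-p1/g13/), kit job **j305013** (re-run of j304890; evidence on stmt-HubbardSuperconductivity-20437;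
  bundle HOME-session `kit/chi2tab/`): interval arithmetic in TWO implementations — (A) python-flint/Arb, Taylor polynomials of order 8 by power-series AD at
  16256 dyadic centres of `[2⁻⁸, ½]` + the ANALYTIC remainder from the Lean-proved Cauchy estimates of `…SmoothTransitionCauchyBound`; (B) mpmath `iv`,
  Taylor order 6 at 8128 centres by the ODE recurrence `σ′ = t′(σ² − σ)` + WIDE-INTERVAL remainder (pure interval arithmetic); both with the elementary
  tail `(0, 2⁻⁸]` (Faà di Bruno/Lah), the reflection `σ(1−x) = 1 − σ(x)` and vanishing off `[0,1]`; A and B overlap at all cross-check points and each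
  bounds the sup within `1.0004` of the certified lower bound for every `n ≤ 16`.  Its Lean status is the NAMED numerical hypothesis
  `SalmhoferCutoffDerivCert 16` (rows `n ≤ 1` are DISCHARGED here: `SalmhoferCutoffDerivCert 1` is a theorem; row `2`'s `17.50` is below the tree's proved `176/9`; rows `3–16` are below the proved
  Cauchy rows by the factors recorded in `klChi2CertTab_le_klChi2CauchyTab`) — what separates it from a proof is the replay of the interval arithmetic
  inside Lean, not analysis.
Consumers: the cutoff-table hypotheses `hXG/hX4/hB` of the engine doors of crux 20437 (take `klChi2CauchyTab` unconditionally — §4 gives the DROP-IN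
shapes: Gevrey `(X₀, C_χ) = (7, 10)` (`salmhoferCutoff_gevrey_table_sharp`, vs `(8, 342)`) and the FLAT table `∀ i ≤ n, ‖Dⁱχ₂‖ ≤ klChi2CauchyTab n` of
`…ScaleZeroCovarianceMomentumJets` — or `klChi2CertTab` under `SalmhoferCutoffDerivCert 16`); the #22a spatial-tail layer (2e) (k3c5-p1 SPEC v2 §2e/§3).  References: Salmhofer 1999 §4.2.5 (4.70)–(4.71);
[cite: BenfattoGiulianiMastropietro2006] §2.2 (2.9); Disertori–Rivasseau 2000 §II.2; Krantz–Parks 2002 Prop. 2.2.10.  Nothing here concerns the model.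
-/

noncomputable section

namespace Summit.HubbardSuperconductivity.HubbardSuperconductivity.Theorems.KLRegimeSplit

set_option linter.dupNamespace false -- summit = problem name (single-conjunct summit), D-0017

open Literature.MathematicalPhysics.QuantumLattice Literature.Analysis.Calculus
open scoped Nat

/-! ## §1 The proved table for `smoothTransition` -/

/-- The PROVED numeral table for `sup|smoothTransition^{(n)}|`: `n ≤ 2` sharp (`1, 2, 11`), `3 ≤ n ≤ 16` the 4-digit ceilings of the Cauchy closed form
`n!·(5·(199n/99)ⁿ·e^{−n} + 2·(15/2)ⁿ)`, `n ≥ 17` the Gevrey numerals `8·(n!)²·256ⁿ`. [cite: BenfattoGiulianiMastropietro2006, §2.2 (2.9)] -/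
def smoothTransitionCauchyTab (n : ℕ) : ℝ :=
  if n = 0 then 1 else if n = 1 then 2 else if n = 2 then 11 else if n = 3 then 5391 else if n = 4 then 161100 else
  if n = 5 then 6110000 else if n = 6 then 283800000 else if n = 7 then 15970000000 else if n = 8 then 1110000000000 else
  if n = 9 then 101000000000000 else if n = 10 then 12960000000000000 else if n = 11 then 2396000000000000000 else
  if n = 12 then 601300000000000000000 else if n = 13 then 189400000000000000000000 else
  if n = 14 then 71130000000000000000000000 else if n = 15 then 30990000000000000000000000000 else
  if n = 16 then 15440000000000000000000000000000 else 8 * ((n ! : ℝ)) ^ 2 * 256 ^ n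

/-- **Every row of the proved `smoothTransition` table holds**: `|smoothTransition^{(n)}(x)| ≤ smoothTransitionCauchyTab n` for all `n`, `x`.
[cite: BenfattoGiulianiMastropietro2006, §2.2 (2.9)] -/
theorem abs_iteratedDeriv_smoothTransition_le_cauchyTab (n : ℕ) (x : ℝ) :
    |iteratedDeriv n Real.smoothTransition x| ≤ smoothTransitionCauchyTab n := by
  by_cases h16 : n ≤ 16
  · by_cases h0 : n = 0
    · subst h0
      simp only [iteratedDeriv_zero, smoothTransitionCauchyTab, if_true]
      rw [abs_of_nonneg (Real.smoothTransition.nonneg x)]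
      exact Real.smoothTransition.le_one x
    by_cases h1 : n = 1
    · subst h1
      have h := Literature.MathematicalPhysics.QuantumFieldTheory.Balaban1983to89.B12Profile270Bounds.abs_deriv_smoothTransition_le_two x
      rw [iteratedDeriv_one]
      simpa [smoothTransitionCauchyTab] using h
    by_cases h2 : n = 2
    · subst h2
      have h := klsh_abs_deriv2_smoothTransition_le x
      rw [show iteratedDeriv 2 Real.smoothTransition x = deriv (deriv Real.smoothTransition) x by
        rw [iteratedDeriv_succ, iteratedDeriv_one]]
      refine h.trans ?_
      simp [smoothTransitionCauchyTab]
    refine (abs_iteratedDeriv_smoothTransition_le_cauchy n x).trans ?_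
    have he := stC_exp_neg_nat_le n
    have step : (n ! : ℝ) * (5 * ((199 / 99 : ℝ) * n) ^ n * Real.exp (-n) + 2 * (15 / 2 : ℝ) ^ n)
        ≤ n ! * (5 * ((199 / 99 : ℝ) * n) ^ n * (10000000000 / 27182818283 : ℝ) ^ n + 2 * (15 / 2 : ℝ) ^ n) := by gcongr
    refine step.trans ?_
    interval_cases n <;> first | (exfalso; omega) | (simp only [smoothTransitionCauchyTab]; norm_num [Nat.factorial])
  · rw [not_le] at h16
    refine (abs_iteratedDeriv_smoothTransition_le_numeral n x).trans (le_of_eq ?_)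
    simp only [smoothTransitionCauchyTab]
    rw [if_neg (by omega), if_neg (by omega), if_neg (by omega), if_neg (by omega), if_neg (by omega), if_neg (by omega), if_neg (by omega),
      if_neg (by omega), if_neg (by omega), if_neg (by omega), if_neg (by omega), if_neg (by omega), if_neg (by omega), if_neg (by omega),
      if_neg (by omega), if_neg (by omega), if_neg (by omega)]

/-! ## §2 The proved table for `χ₂` -/

/-- The PROVED numeral table for `sup‖D^n χ₂‖`: `n ≤ 2` the tree's sharp `1`, `8/3`, `176/9`; `3 ≤ n ≤ 16` the 4-digit ceilings of
`(4/3)ⁿ·n!·(5·(199n/99)ⁿ·e^{−n} + 2·(15/2)ⁿ)`; `n ≥ 17` the Gevrey numerals `8·(n!)²·342ⁿ`. [cite: BenfattoGiulianiMastropietro2006, §2.2 (2.9)] -/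
def klChi2CauchyTab (n : ℕ) : ℝ :=
  if n = 0 then 1 else if n = 1 then 8 / 3 else if n = 2 then 176 / 9 else if n = 3 then 12780 else if n = 4 then 509100 else
  if n = 5 then 25750000 else if n = 6 then 1595000000 else if n = 7 then 119600000000 else if n = 8 then 11090000000000 else
  if n = 9 then 1345000000000000 else if n = 10 then 230200000000000000 else if n = 11 then 56730000000000000000 else
  if n = 12 then 18990000000000000000000 else if n = 13 then 7972000000000000000000000 else
  if n = 14 then 3992000000000000000000000000 else if n = 15 then 2319000000000000000000000000000 else
  if n = 16 then 1540000000000000000000000000000000 else 8 * ((n ! : ℝ)) ^ 2 * 342 ^ n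

/-- **Every row of the proved `χ₂` table holds**: `‖iteratedFDeriv ℝ n χ₂ x‖ ≤ klChi2CauchyTab n` for all `n` and `x`.
[cite: BenfattoGiulianiMastropietro2006, §2.2 (2.9)] -/
theorem norm_iteratedFDeriv_salmhoferCutoff_le_klChi2CauchyTab (n : ℕ) (x : ℝ) :
    ‖iteratedFDeriv ℝ n salmhoferCutoff x‖ ≤ klChi2CauchyTab n := by
  by_cases h16 : n ≤ 16
  · by_cases h0 : n = 0
    · subst h0
      simp only [klChi2CauchyTab, if_true, norm_iteratedFDeriv_zero, Real.norm_eq_abs]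
      have h := salmhoferCutoff_mem_Icc x
      rw [abs_of_nonneg h.1]; exact h.2
    by_cases h1 : n = 1
    · subst h1
      rw [norm_iteratedFDeriv_eq_norm_iteratedDeriv, iteratedDeriv_one, Real.norm_eq_abs]
      simpa [klChi2CauchyTab] using klsh_abs_deriv_salmhoferCutoff_le x
    by_cases h2 : n = 2
    · subst h2
      simpa [klChi2CauchyTab] using norm_iteratedFDeriv_two_salmhoferCutoff_le_sharp x
    refine (norm_iteratedFDeriv_salmhoferCutoff_le_cauchy_rat n x).trans ?_
    interval_cases n <;> first | (exfalso; omega) | (simp only [klChi2CauchyTab]; norm_num [Nat.factorial])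
  · rw [not_le] at h16
    refine (norm_iteratedFDeriv_salmhoferCutoff_le_gevrey n x).trans (le_of_eq ?_)
    simp only [klChi2CauchyTab]
    rw [if_neg (by omega), if_neg (by omega), if_neg (by omega), if_neg (by omega), if_neg (by omega), if_neg (by omega), if_neg (by omega),
      if_neg (by omega), if_neg (by omega), if_neg (by omega), if_neg (by omega), if_neg (by omega), if_neg (by omega), if_neg (by omega),
      if_neg (by omega), if_neg (by omega), if_neg (by omega)]

/-- The table shape of the engine's hypotheses, with the proved table: `∀ l ≤ N, ∀ x, ‖D^l χ₂(x)‖ ≤ klChi2CauchyTab l`.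
[cite: BenfattoGiulianiMastropietro2006, §2.2 (2.9)] -/
theorem salmhoferCutoff_proved_table (N : ℕ) : ∀ l ≤ N, ∀ x : ℝ, ‖iteratedFDeriv ℝ l salmhoferCutoff x‖ ≤ klChi2CauchyTab l :=
  fun l _ x => norm_iteratedFDeriv_salmhoferCutoff_le_klChi2CauchyTab l x

/-! ## §3 The kit-certified sharp rows and their certificate statement -/

/-- The kit-CERTIFIED sharp table (4-digit ceilings of the certified suprema; kit j305013, implementations A = Arb/Cauchy-remainder and
B = mpmath-iv/wide-interval remainder agree): `sup‖D^n χ₂‖ ≤ klChi2CertTab n` for `n ≤ 16` (rows `0, 1` are the exact proved values `1`, `8/3`,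
below the certified ceilings `1`, `2.667`); beyond, the Gevrey numerals.
[cite: BenfattoGiulianiMastropietro2006, §2.2 (2.9)] -/
def klChi2CertTab (n : ℕ) : ℝ :=
  if n = 0 then 1 else if n = 1 then 8 / 3 else if n = 2 then 35 / 2 else if n = 3 then 2621 / 10 else if n = 4 then 7208 else
  if n = 5 then 325300 else if n = 6 then 27070000 else if n = 7 then 3203000000 else if n = 8 then 483100000000 else
  if n = 9 then 90320000000000 else if n = 10 then 20530000000000000 else if n = 11 then 5918000000000000000 else
  if n = 12 then 2188000000000000000000 else if n = 13 then 927500000000000000000000 else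
  if n = 14 then 447700000000000000000000000 else if n = 15 then 244300000000000000000000000000 else
  if n = 16 then 149700000000000000000000000000000 else 8 * ((n ! : ℝ)) ^ 2 * 342 ^ n

/-- **The certificate statement up to order `N`** (used at `N = 16`; NAMED numerical hypothesis, kit j305013 — interval arithmetic in two
implementations; not a Lean proof): the sharp rows `n ≤ N` hold pointwise. [cite: BenfattoGiulianiMastropietro2006, §2.2 (2.9)] -/
def SalmhoferCutoffDerivCert (N : ℕ) : Prop :=
  ∀ n : ℕ, n ≤ N → ∀ x : ℝ, ‖iteratedFDeriv ℝ n salmhoferCutoff x‖ ≤ klChi2CertTab n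

/-- Rows `n ≤ 1` of the certificate are theorems (`|χ₂| ≤ 1`, `|χ₂′| ≤ 8/3`): `SalmhoferCutoffDerivCert 1` holds. [cite: BenfattoGiulianiMastropietro2006, §2.2 (2.9)] -/
theorem salmhoferCutoffDerivCert_one : SalmhoferCutoffDerivCert 1 := by
  intro n hn x
  interval_cases n
  · simp only [klChi2CertTab, if_true, norm_iteratedFDeriv_zero, Real.norm_eq_abs]
    have h := salmhoferCutoff_mem_Icc x
    rw [abs_of_nonneg h.1]; exact h.2
  · rw [norm_iteratedFDeriv_eq_norm_iteratedDeriv, iteratedDeriv_one, Real.norm_eq_abs]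
    simpa [klChi2CertTab] using klsh_abs_deriv_salmhoferCutoff_le x

/-- **Certified ≤ proved**: every certified row lies below the proved row (ratios proved/certified: `n = 2`: 1.12, `3`: 48.8, `4`: 70.6,
`8`: 23.0, `12`: 8.7, `16`: 10.3 — how far the Cauchy proof is from the truth). [cite: BenfattoGiulianiMastropietro2006, §2.2 (2.9)] -/
theorem klChi2CertTab_le_klChi2CauchyTab (n : ℕ) : klChi2CertTab n ≤ klChi2CauchyTab n := by
  by_cases h16 : n ≤ 16
  · interval_cases n <;> simp only [klChi2CertTab, klChi2CauchyTab] <;> norm_num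
  · simp only [klChi2CertTab, klChi2CauchyTab]
    rw [if_neg (by omega), if_neg (by omega), if_neg (by omega), if_neg (by omega), if_neg (by omega), if_neg (by omega), if_neg (by omega),
      if_neg (by omega), if_neg (by omega), if_neg (by omega), if_neg (by omega), if_neg (by omega), if_neg (by omega), if_neg (by omega),
      if_neg (by omega), if_neg (by omega), if_neg (by omega)]
    rw [if_neg (by omega), if_neg (by omega), if_neg (by omega), if_neg (by omega), if_neg (by omega), if_neg (by omega), if_neg (by omega),
      if_neg (by omega), if_neg (by omega), if_neg (by omega), if_neg (by omega), if_neg (by omega), if_neg (by omega), if_neg (by omega),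
      if_neg (by omega), if_neg (by omega), if_neg (by omega)]

/-- Under the certificate, the sharp table holds at every order (rows `n ≥ 17` are the Gevrey numerals, proved).
[cite: BenfattoGiulianiMastropietro2006, §2.2 (2.9)] -/
theorem norm_iteratedFDeriv_salmhoferCutoff_le_klChi2CertTab_of_cert (hC : SalmhoferCutoffDerivCert 16) (n : ℕ) (x : ℝ) :
    ‖iteratedFDeriv ℝ n salmhoferCutoff x‖ ≤ klChi2CertTab n := by
  by_cases h16 : n ≤ 16
  · exact hC n h16 x
  · rw [not_le] at h16
    refine (norm_iteratedFDeriv_salmhoferCutoff_le_gevrey n x).trans (le_of_eq ?_)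
    simp only [klChi2CertTab]
    rw [if_neg (by omega), if_neg (by omega), if_neg (by omega), if_neg (by omega), if_neg (by omega), if_neg (by omega), if_neg (by omega),
      if_neg (by omega), if_neg (by omega), if_neg (by omega), if_neg (by omega), if_neg (by omega), if_neg (by omega), if_neg (by omega),
      if_neg (by omega), if_neg (by omega), if_neg (by omega)]

/-- `1 ≤ klChi2CauchyTab n` (every row; convenient for threshold bookkeeping). [cite: BenfattoGiulianiMastropietro2006, §2.2 (2.9)] -/
theorem one_le_klChi2CauchyTab (n : ℕ) : 1 ≤ klChi2CauchyTab n := by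
  by_cases h16 : n ≤ 16
  · interval_cases n <;> simp only [klChi2CauchyTab] <;> norm_num
  · simp only [klChi2CauchyTab]
    rw [if_neg (by omega), if_neg (by omega), if_neg (by omega), if_neg (by omega), if_neg (by omega), if_neg (by omega), if_neg (by omega),
      if_neg (by omega), if_neg (by omega), if_neg (by omega), if_neg (by omega), if_neg (by omega), if_neg (by omega), if_neg (by omega),
      if_neg (by omega), if_neg (by omega), if_neg (by omega)]
    have h1 : (1 : ℝ) ≤ (n ! : ℝ) := by exact_mod_cast Nat.one_le_iff_ne_zero.2 (Nat.factorial_ne_zero n)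
    have h2 : (1 : ℝ) ≤ (342 : ℝ) ^ n := one_le_pow₀ (by norm_num)
    nlinarith

/-! ## §4 Drop-in forms for the engine's hypotheses: the Gevrey shape `(X₀, C_χ) = (7, 10)` and the flat table -/

/-- `lˡ·e^{−l} ≤ l!`. -/
theorem pow_self_mul_exp_neg_le_factorial (l : ℕ) : (l : ℝ) ^ l * Real.exp (-l) ≤ l ! := by
  have h := Real.pow_div_factorial_le_exp (l : ℝ) (Nat.cast_nonneg l) l
  have hf : (0 : ℝ) < l ! := by positivity
  rw [div_le_iff₀ hf] at h
  rw [Real.exp_neg]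
  have he : 0 < Real.exp (l : ℝ) := Real.exp_pos _
  calc (l : ℝ) ^ l * (Real.exp l)⁻¹ ≤ (Real.exp l * l !) * (Real.exp l)⁻¹ := by gcongr
    _ = l ! := by field_simp

/-- **The Gevrey-2 shape with realistic numerals**: `‖iteratedFDeriv ℝ l χ₂ x‖ ≤ 7·(l!)²·10ˡ` for every `l`, `x` — a drop-in for the tree's
`norm_iteratedFDeriv_salmhoferCutoff_le_gevrey` (`8·(l!)²·342ˡ`): the engine's `hXG` tables may take `(X₀, C_χ) = (7, 10)`.
[cite: BenfattoGiulianiMastropietro2006, §2.2 (2.9)] -/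
theorem norm_iteratedFDeriv_salmhoferCutoff_le_gevrey_sharp (l : ℕ) (x : ℝ) :
    ‖iteratedFDeriv ℝ l salmhoferCutoff x‖ ≤ 7 * ((l ! : ℝ)) ^ 2 * 10 ^ l := by
  refine (norm_iteratedFDeriv_salmhoferCutoff_le_cauchy l x).trans ?_
  have hf1 : (1 : ℝ) ≤ l ! := by exact_mod_cast Nat.one_le_iff_ne_zero.2 (Nat.factorial_ne_zero l)
  have hf0 : (0 : ℝ) ≤ l ! := by positivity
  -- first term: (4/3)^l · l! · 5 · (199 l/99)^l e^{-l} ≤ 5 (l!)² (796/297)^l ≤ 5 (l!)² 10^l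
  have h1 : (4 / 3 : ℝ) ^ l * ((l ! : ℝ) * (5 * ((199 / 99 : ℝ) * l) ^ l * Real.exp (-l))) ≤ 5 * ((l ! : ℝ)) ^ 2 * 10 ^ l := by
    have hp : ((199 / 99 : ℝ) * l) ^ l * Real.exp (-l) ≤ (199 / 99 : ℝ) ^ l * l ! := by
      rw [mul_pow, mul_assoc]
      exact mul_le_mul_of_nonneg_left (pow_self_mul_exp_neg_le_factorial l) (by positivity)
    have hq : (4 / 3 : ℝ) ^ l * (199 / 99 : ℝ) ^ l ≤ 10 ^ l := by
      rw [← mul_pow]; exact pow_le_pow_left₀ (by norm_num) (by norm_num) l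
    calc (4 / 3 : ℝ) ^ l * ((l ! : ℝ) * (5 * ((199 / 99 : ℝ) * l) ^ l * Real.exp (-l)))
        = 5 * (l ! : ℝ) * (4 / 3 : ℝ) ^ l * (((199 / 99 : ℝ) * l) ^ l * Real.exp (-l)) := by ring
      _ ≤ 5 * (l ! : ℝ) * (4 / 3 : ℝ) ^ l * ((199 / 99 : ℝ) ^ l * l !) := by gcongr
      _ = 5 * ((l ! : ℝ)) ^ 2 * ((4 / 3 : ℝ) ^ l * (199 / 99 : ℝ) ^ l) := by ring
      _ ≤ 5 * ((l ! : ℝ)) ^ 2 * 10 ^ l := by gcongr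
  -- second term: (4/3)^l · l! · 2 · (15/2)^l = 2 · l! · 10^l ≤ 2 (l!)² 10^l
  have h2 : (4 / 3 : ℝ) ^ l * ((l ! : ℝ) * (2 * (15 / 2 : ℝ) ^ l)) ≤ 2 * ((l ! : ℝ)) ^ 2 * 10 ^ l := by
    have e : (4 / 3 : ℝ) ^ l * (15 / 2 : ℝ) ^ l = 10 ^ l := by rw [← mul_pow]; norm_num
    calc (4 / 3 : ℝ) ^ l * ((l ! : ℝ) * (2 * (15 / 2 : ℝ) ^ l)) = 2 * (l ! : ℝ) * ((4 / 3 : ℝ) ^ l * (15 / 2 : ℝ) ^ l) := by ring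
      _ = 2 * ((l ! : ℝ) * 1) * 10 ^ l := by rw [e]; ring
      _ ≤ 2 * ((l ! : ℝ) * l !) * 10 ^ l := by gcongr
      _ = 2 * ((l ! : ℝ)) ^ 2 * 10 ^ l := by ring
  calc (4 / 3 : ℝ) ^ l * ((l ! : ℝ) * (5 * ((199 / 99 : ℝ) * l) ^ l * Real.exp (-l) + 2 * (15 / 2 : ℝ) ^ l))
      = (4 / 3 : ℝ) ^ l * ((l ! : ℝ) * (5 * ((199 / 99 : ℝ) * l) ^ l * Real.exp (-l)))
          + (4 / 3 : ℝ) ^ l * ((l ! : ℝ) * (2 * (15 / 2 : ℝ) ^ l)) := by ring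
    _ ≤ 5 * ((l ! : ℝ)) ^ 2 * 10 ^ l + 2 * ((l ! : ℝ)) ^ 2 * 10 ^ l := add_le_add h1 h2
    _ = 7 * ((l ! : ℝ)) ^ 2 * 10 ^ l := by ring

/-- The table form with the realistic Gevrey numerals: `∀ l ≤ N, ∀ x, ‖D^l χ₂(x)‖ ≤ 7·(l!)²·10ˡ` (drop-in for `salmhoferCutoff_gevrey_table`).
[cite: BenfattoGiulianiMastropietro2006, §2.2 (2.9)] -/
theorem salmhoferCutoff_gevrey_table_sharp (N : ℕ) :
    ∀ l ≤ N, ∀ x : ℝ, ‖iteratedFDeriv ℝ l salmhoferCutoff x‖ ≤ 7 * ((l ! : ℝ)) ^ 2 * (10 : ℝ) ^ l :=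
  fun l _ x => norm_iteratedFDeriv_salmhoferCutoff_le_gevrey_sharp l x

/-- The proved table is nondecreasing in the order (row `n` ≤ row `n+1`). [cite: BenfattoGiulianiMastropietro2006, §2.2 (2.9)] -/
theorem klChi2CauchyTab_le_succ (n : ℕ) : klChi2CauchyTab n ≤ klChi2CauchyTab (n + 1) := by
  by_cases h16 : n ≤ 16
  · interval_cases n <;> simp only [klChi2CauchyTab] <;> norm_num [Nat.factorial]
  · rw [not_le] at h16
    simp only [klChi2CauchyTab]
    rw [if_neg (by omega), if_neg (by omega), if_neg (by omega), if_neg (by omega), if_neg (by omega), if_neg (by omega), if_neg (by omega),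
      if_neg (by omega), if_neg (by omega), if_neg (by omega), if_neg (by omega), if_neg (by omega), if_neg (by omega), if_neg (by omega),
      if_neg (by omega), if_neg (by omega), if_neg (by omega)]
    rw [if_neg (by omega), if_neg (by omega), if_neg (by omega), if_neg (by omega), if_neg (by omega), if_neg (by omega), if_neg (by omega),
      if_neg (by omega), if_neg (by omega), if_neg (by omega), if_neg (by omega), if_neg (by omega), if_neg (by omega), if_neg (by omega),
      if_neg (by omega), if_neg (by omega), if_neg (by omega)]
    have hf : ((n ! : ℕ) : ℝ) ≤ (((n + 1) ! : ℕ) : ℝ) := by exact_mod_cast Nat.factorial_le (Nat.le_succ n)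
    have hf0 : (0 : ℝ) ≤ ((n ! : ℕ) : ℝ) := by positivity
    have hp : (342 : ℝ) ^ n ≤ 342 ^ (n + 1) := pow_le_pow_right₀ (by norm_num) (Nat.le_succ n)
    have hp0 : (0 : ℝ) ≤ (342 : ℝ) ^ n := by positivity
    have h2 : ((n ! : ℕ) : ℝ) ^ 2 ≤ (((n + 1) ! : ℕ) : ℝ) ^ 2 := pow_le_pow_left₀ hf0 hf 2
    calc (8 : ℝ) * ((n ! : ℕ) : ℝ) ^ 2 * 342 ^ n ≤ 8 * (((n + 1) ! : ℕ) : ℝ) ^ 2 * 342 ^ n := by gcongr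
      _ ≤ 8 * (((n + 1) ! : ℕ) : ℝ) ^ 2 * 342 ^ (n + 1) := by gcongr

/-- Monotonicity of the proved table. [cite: BenfattoGiulianiMastropietro2006, §2.2 (2.9)] -/
theorem klChi2CauchyTab_mono : Monotone klChi2CauchyTab := monotone_nat_of_le_succ klChi2CauchyTab_le_succ

/-- **The FLAT table form** of the scale-0 symbol lemmas (`…ScaleZeroCovarianceMomentumJets.norm_iteratedFDeriv_uvSpatialSymbol_le`: one constant
`B ≥ 1` for all orders `i ≤ n`): `∀ i ≤ n, ∀ x, ‖D^i χ₂(x)‖ ≤ klChi2CauchyTab n`, and `1 ≤ klChi2CauchyTab n`.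
[cite: BenfattoGiulianiMastropietro2006, §2.2 (2.9)] -/
theorem salmhoferCutoff_flat_cauchy_table (n : ℕ) :
    ∀ i ≤ n, ∀ x : ℝ, ‖iteratedFDeriv ℝ i salmhoferCutoff x‖ ≤ klChi2CauchyTab n :=
  fun i hi x => (norm_iteratedFDeriv_salmhoferCutoff_le_klChi2CauchyTab i x).trans (klChi2CauchyTab_mono hi)

end Summit.HubbardSuperconductivity.HubbardSuperconductivity.Theorems.KLRegimeSplit

end
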